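import Summits.QuantumFields.QCD.Theses.PauliWegnerSea
import Literature.MathematicalPhysics.QuantumFieldTheory.QCDHeavyQuarkPropagator
import Literature.MathematicalPhysics.QuantumLattice.OverlapLocality
import Literature.Barriers.QuantumFields.HoppingExpansionLocality

/-!
# Crux `FMClosureUnquenched` (stmt-QuantumFields-11512), line `thick-collar-far-stability` — stub `stub_hopping`

**Hopping decay of the phase-quenched fractional moment in the heavy / negative-heavy window
`|m_f + 4| ≥ 41/10`.**  For every `N_f` there are `C = 1440 ≥ 0` and `μ = log (41/40) > 0` such
that for every coupling `β`, every bare-mass tuple `mq`, every flavour `f` with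
`41/10 ≤ |mq f + 4|`, every `S`, every `s ∈ (0,1)` and every `v ∈ box 4 S`, the
`|det (diracMatrix U mq)|`-reweighted Wilson average of
`(Σ_{a,i,b,j} |(diracMatrix U mq)⁻¹((f,0,a,i),(f,v,b,j))|)^s` on the torus of side `2S+1` is
`≤ C · exp (−μ s ‖v‖)` (`stub_hopping`, the lead's `cruxMoment Nf β mq S f v s` verbatim).

Proof (convergent hopping-parameter / Neumann series, configuration-wise, then integrated):

* `norm_inv_wilsonDirac_apply_le_of_abs` — the `|m+4|`-variant (both signs of `m + 4`) of the tree's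
  `norm_inv_wilsonDirac_apply_le`: with `c = m + 4`, `|c| > 4`, `D_W(m) = c (1 − x)`,
  `x = c⁻¹ Σ_μ W_μ`, `‖x‖₂ ≤ 4/|c| < 1` (`l2_opNorm_wilsonHop_le`), so `det D_W ≠ 0`,
  `D_W⁻¹ = c⁻¹ Σ_n xⁿ` (`mul_neg_geom_series`) and, since `xⁿ(p,q) = 0` for `n < d_i(p,q)`
  (`pow_apply_eq_zero_of_lt_valMinAbs`), `|D_W⁻¹(p,q)| ≤ |c|⁻¹ (1 − 4/|c|)⁻¹ (4/|c|)^{d_i(p,q)}`;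
  in the window `|c| ≥ 41/10` this is `≤ 10 · (40/41)^{d_i(p,q)}`
  (`norm_inv_wilsonDirac_apply_le_window`).
* Measure part, copied from the tree's `phaseQuenched_fractionalMoment_decay_of_heavy`: with `i₀` a
  maximal coordinate of `v` and `n = |v i₀| ≥ ‖v‖`, the cyclic distance of the `i₀`-th coordinates
  of `0` and `v` on the torus of side `2S+1` is `n`; POINTWISE in `U`, either some flavour `g` has
  `det D_W(mq g) = 0`, then `|det (diracMatrix U mq)| = 0` (`norm_det_diracMatrix`) and the
  integrand vanishes, or all flavours are invertible and `inv_diracMatrix_apply_same_flavour` plus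
  the entry bound give `Σ ≤ 144 · 10 · (40/41)^n`, hence
  `Σ^s ≤ 1440^s (40/41)^{n s} ≤ 1440 · exp (−μ s ‖v‖)`.  Integrating (`integral_mono_of_nonneg`,
  `integrable_norm_det_diracMatrix`) bounds the numerator by `(∫ |det|) · B`; the quotient is then
  `≤ B` (`div_le_iff₀`, or `x / 0 = 0 ≤ B` if the denominator vanishes).

References: I. Montvay, G. Münster, *Quantum Fields on a Lattice* (CUP 1994), §4.1, §5.1
[MontvayMunster1994]; P. Hernández, K. Jansen, M. Lüscher, Nucl. Phys. B 552 (1999) 363, (2.13)–(2.14)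
[HernandezJansenLuscher1999].
-/

noncomputable section

namespace Summit.QuantumFields.QCD.Theorems.ThickCollarFarStability

open scoped BigOperators Topology
open MeasureTheory Filter Literature.MathematicalPhysics.QuantumFieldTheory
  Literature.MathematicalPhysics.QuantumLattice Literature.Probability.LatticeModels

/-! ### Configuration-wise Neumann bound for `|m + 4| > 4` (both signs of `m + 4`) -/

section Neumann

open scoped Matrix.Norms.L2Operator

variable {L N : ℕ} {G : Type*} [Group G] (ρ : G →* Matrix (Fin N) (Fin N) ℂ) [NeZero L]

/-- `‖1 − (m+4)⁻¹ D_W(m)‖₂ ≤ 4/|m+4|` for `m + 4 ≠ 0` (four hopping contractions, HJL (2.14)); the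
`|·|`-variant of the tree's `norm_one_sub_smul_wilsonDirac_le`.
[cite: HernandezJansenLuscher1999, (2.14)] -/
private theorem norm_one_sub_smul_wilsonDirac_le_abs
    (hρ : ∀ g, ρ g ∈ Matrix.unitaryGroup (Fin N) ℂ) (U : GaugeConfig 4 L G) (m : ℝ)
    (hc : m + 4 ≠ 0) :
    ‖(1 : Matrix _ _ ℂ) - ((m + 4 : ℝ) : ℂ)⁻¹ • wilsonDirac ρ U m 1‖ ≤ 4 / |m + 4| := by
  -- adapted from `Literature.MathematicalPhysics.QuantumLattice.norm_one_sub_smul_wilsonDirac_le`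
  rw [one_sub_smul_wilsonDirac_eq ρ hρ U m hc, norm_smul, norm_inv, Complex.norm_real,
    Real.norm_eq_abs, div_eq_inv_mul]
  gcongr
  calc ‖∑ μ, wilsonHop ρ U μ‖ ≤ ∑ μ, ‖wilsonHop ρ U μ‖ := norm_sum_le _ _
    _ ≤ ∑ _μ : Fin 4, (1 : ℝ) := Finset.sum_le_sum fun μ _ => l2_opNorm_wilsonHop_le ρ hρ U μ
    _ = 4 := by simp

/-- **Neumann bound, both signs of `m + 4`.** For `|m + 4| > 4`, on every periodic torus and for
every gauge field, `det D_W(m) ≠ 0` and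
`|D_W(m)⁻¹(p,q)| ≤ |m+4|⁻¹ (1 − 4/|m+4|)⁻¹ (4/|m+4|)^{d_i(p,q)}` for each coordinate `i` (`d_i` the
cyclic distance of the `i`-th site coordinates): `D = (m+4)(1 − x)`, `‖x‖ ≤ 4/|m+4| < 1`,
`D⁻¹ = (m+4)⁻¹ Σ_n xⁿ`, and `xⁿ(p,q) = 0` for `n < d_i(p,q)`, so only the tail `x^d Σ_n xⁿ`
contributes to the entry.  Adapted from the tree's `norm_inv_wilsonDirac_apply_le` (`m > 0`).
[cite: MontvayMunster1994, §4.1 and §5.1 (hopping parameter expansion)] -/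
private theorem norm_inv_wilsonDirac_apply_le_of_abs
    (hρ : ∀ g, ρ g ∈ Matrix.unitaryGroup (Fin N) ℂ) (U : GaugeConfig 4 L G) {m : ℝ}
    (hm : 4 < |m + 4|) (p q : TorusSite 4 L × Fin N × Fin 4) (i : Fin 4) :
    (wilsonDirac ρ U m 1).det ≠ 0 ∧
    ‖(wilsonDirac ρ U m 1)⁻¹ p q‖ ≤
      |m + 4|⁻¹ * (1 - 4 / |m + 4|)⁻¹ * (4 / |m + 4|) ^ (p.1 i - q.1 i).valMinAbs.natAbs := by
  -- adapted from `Literature.MathematicalPhysics.QuantumLattice.norm_inv_wilsonDirac_apply_le`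
  set c : ℝ := m + 4 with hcdef
  have hc0 : 0 < |c| := by linarith
  have hc : c ≠ 0 := abs_pos.1 hc0
  set θ : ℝ := 4 / |c| with hθ
  have hθ1 : θ < 1 := by rwa [hθ, div_lt_one hc0]
  have hθ0 : 0 ≤ θ := by positivity
  set x : Matrix (TorusSite 4 L × Fin N × Fin 4) (TorusSite 4 L × Fin N × Fin 4) ℂ :=
    1 - ((c : ℝ) : ℂ)⁻¹ • wilsonDirac ρ U m 1 with hx
  have hxn : ‖x‖ ≤ θ := norm_one_sub_smul_wilsonDirac_le_abs ρ hρ U m hc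
  have hxn1 : ‖x‖ < 1 := hxn.trans_lt hθ1
  set T : Matrix (TorusSite 4 L × Fin N × Fin 4) (TorusSite 4 L × Fin N × Fin 4) ℂ := ∑' n, x ^ n
    with hTdef
  have hT1 : (1 - x) * T = 1 := mul_neg_geom_series x hxn1
  have hc' : ((c : ℝ) : ℂ) ≠ 0 := by exact_mod_cast hc
  have hD : wilsonDirac ρ U m 1 = ((c : ℝ) : ℂ) • (1 - x) := by
    rw [hx, sub_sub_cancel, smul_smul, mul_inv_cancel₀ hc', one_smul]
  have hinv : wilsonDirac ρ U m 1 * (((c : ℝ) : ℂ)⁻¹ • T) = 1 := by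
    rw [hD, smul_mul_smul_comm, mul_inv_cancel₀ hc', one_smul, hT1]
  have hdet : (wilsonDirac ρ U m 1).det ≠ 0 := by
    intro h0
    have := congrArg Matrix.det hinv
    rw [Matrix.det_mul, h0, zero_mul, Matrix.det_one] at this
    exact zero_ne_one this
  refine ⟨hdet, ?_⟩
  rw [Matrix.inv_eq_right_inv hinv, Matrix.smul_apply, norm_smul, norm_inv, Complex.norm_real,
    Real.norm_eq_abs, mul_assoc]
  gcongr
  set d : ℕ := (p.1 i - q.1 i).valMinAbs.natAbs with hd
  have hNN : ∀ p' q' : TorusSite 4 L × Fin N × Fin 4,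
      ¬ (p'.1 = q'.1 ∨ ∃ μ,
          q'.1 = Literature.MathematicalPhysics.QuantumFieldTheory.Site.shift p'.1 μ ∨
          p'.1 = Literature.MathematicalPhysics.QuantumFieldTheory.Site.shift q'.1 μ) →
        x p' q' = 0 := by
    intro p' q' h
    have hpq : p' ≠ q' := fun e => h (Or.inl (by rw [e]))
    simp only [not_or, not_exists] at h
    rw [hx, Matrix.sub_apply, Matrix.smul_apply, Matrix.one_apply_ne hpq,
      wilsonDirac_apply_eq_zero_of_far ρ U m 1 h.1 (fun μ => (h.2 μ).1) (fun μ => (h.2 μ).2),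
      smul_zero, sub_zero]
  have htail := geom_series_eq_sum_add_pow_mul hT1 d
  have hzero : (∑ n ∈ Finset.range d, x ^ n) p q = 0 := by
    rw [Matrix.sum_apply]
    exact Finset.sum_eq_zero fun n hn =>
      pow_apply_eq_zero_of_lt_valMinAbs hNN i n p q (Finset.mem_range.1 hn)
  have hTpq : T p q = (x ^ d * T) p q := by
    conv_lhs => rw [htail]
    rw [Matrix.add_apply, hzero, zero_add]
  have hTnorm : ‖T‖ ≤ (1 - θ)⁻¹ := by
    refine (tsum_geometric_le_of_norm_lt_one x hxn1).trans ?_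
    have h1 := l2_opNorm_torusFermion_one_le (L := L) (N := N)
    have h2 : (1 - ‖x‖)⁻¹ ≤ (1 - θ)⁻¹ := by
      apply inv_anti₀ (by linarith) (by linarith)
    linarith
  have hxd : ‖x ^ d‖ ≤ θ ^ d := by
    rcases Nat.eq_zero_or_pos d with h0 | hpos
    · rw [h0, pow_zero, pow_zero]; exact l2_opNorm_torusFermion_one_le
    · exact (norm_pow_le' x hpos).trans (pow_le_pow_left₀ (norm_nonneg _) hxn d)
  calc ‖T p q‖ = ‖(x ^ d * T) p q‖ := by rw [hTpq]
    _ ≤ ‖x ^ d * T‖ := Literature.MathematicalPhysics.QuantumLattice.norm_apply_le_l2_opNorm _ p q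
    _ ≤ ‖x ^ d‖ * ‖T‖ := norm_mul_le _ _
    _ ≤ θ ^ d * (1 - θ)⁻¹ := mul_le_mul hxd hTnorm (norm_nonneg _) (pow_nonneg hθ0 d)
    _ = (1 - 4 / |c|)⁻¹ * (4 / |c|) ^ d := by rw [hθ, mul_comm]

/-- **Numeric form in the window `|m + 4| ≥ 41/10`**: `det D_W(m) ≠ 0` and
`|D_W(m)⁻¹(p,q)| ≤ 10 · (40/41)^{d_i(p,q)}` for every coordinate `i`
(`|m+4|⁻¹ ≤ 10/41`, `(1 − 4/|m+4|)⁻¹ ≤ 41`, `4/|m+4| ≤ 40/41`), uniformly in the torus and the field.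
[cite: MontvayMunster1994, §4.1 and §5.1 (hopping parameter expansion)] -/
private theorem norm_inv_wilsonDirac_apply_le_window
    (hρ : ∀ g, ρ g ∈ Matrix.unitaryGroup (Fin N) ℂ) (U : GaugeConfig 4 L G) {m : ℝ}
    (hm : (41 / 10 : ℝ) ≤ |m + 4|) (p q : TorusSite 4 L × Fin N × Fin 4) (i : Fin 4) :
    (wilsonDirac ρ U m 1).det ≠ 0 ∧
    ‖(wilsonDirac ρ U m 1)⁻¹ p q‖ ≤ 10 * (40 / 41 : ℝ) ^ (p.1 i - q.1 i).valMinAbs.natAbs := by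
  obtain ⟨hdet, hb⟩ := norm_inv_wilsonDirac_apply_le_of_abs ρ hρ U (by linarith) p q i
  refine ⟨hdet, hb.trans ?_⟩
  have hc0 : 0 < |m + 4| := by linarith
  have hθ : 4 / |m + 4| ≤ 40 / 41 := by
    rw [div_le_iff₀ hc0]; linarith
  have hθ0 : 0 ≤ 4 / |m + 4| := by positivity
  have h1 : |m + 4|⁻¹ ≤ 10 / 41 := (inv_anti₀ (by norm_num) hm).trans_eq (by norm_num)
  have h2 : (1 - 4 / |m + 4|)⁻¹ ≤ 41 :=
    (inv_anti₀ (by norm_num) (show (1 / 41 : ℝ) ≤ 1 - 4 / |m + 4| by linarith)).trans_eq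
      (by norm_num)
  have h12 : |m + 4|⁻¹ * (1 - 4 / |m + 4|)⁻¹ ≤ 10 :=
    calc |m + 4|⁻¹ * (1 - 4 / |m + 4|)⁻¹ ≤ (10 / 41) * 41 :=
          mul_le_mul h1 h2 (inv_nonneg.2 (by linarith)) (by norm_num)
      _ = 10 := by norm_num
  exact mul_le_mul h12 (pow_le_pow_left₀ hθ0 hθ _) (pow_nonneg hθ0 _) (by norm_num)

end Neumann

/-! ### The phase-quenched fractional moment in the hopping window -/

/-- **Hopping decay** (registered stub `stub_hopping` of line `thick-collar-far-stability`, crux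
`PauliWegnerSea.FMClosureUnquenched`): for every `N_f` there are `C ≥ 0`, `μ > 0` (here `C = 1440`,
`μ = log (41/40)`) such that for all `β`, all bare masses `mq`, every flavour `f` in the hopping
window `41/10 ≤ |mq f + 4|`, all `S`, all `s ∈ (0,1)` and all `v ∈ box 4 S`, the
`|det (diracMatrix U mq)|`-reweighted Wilson average of
`(Σ_{a,i,b,j} |(diracMatrix U mq)⁻¹((f,0,a,i),(f,v,b,j))|)^s` on the torus of side `2S+1` is
`≤ C · exp (−μ s ‖v‖)`.  Configuration-wise Neumann (hopping-parameter) bound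
`|D_W(m_f)⁻¹(p,q)| ≤ 10 (40/41)^{d(p,q)}` integrated against the positive weight; configurations
where another flavour's Wilson matrix is singular carry weight `|det| = 0`.
[cite: MontvayMunster1994, §5.1.2 (hopping parameter expansion)] -/
theorem stub_hopping : ∀ Nf : ℕ,
    ∃ C μ : ℝ, 0 ≤ C ∧ 0 < μ ∧ ∀ (β : ℝ) (mq : Fin Nf → ℝ) (f : Fin Nf), (41 / 10 : ℝ) ≤ |mq f + 4| →
        ∀ (S : ℕ) (s : ℝ), 0 < s → s < 1 →
          ∀ v : Literature.Probability.LatticeModels.Site 4, v ∈ box 4 S →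
            (∫ U : GaugeConfig 4 (2 * S + 1) (Matrix.specialUnitaryGroup (Fin 3) ℂ),
                ‖(diracMatrix U mq).det‖ *
                  (∑ a : Fin 3, ∑ i : Fin 4, ∑ b : Fin 3, ∑ j : Fin 4,
                    ‖(diracMatrix U mq)⁻¹ (quarkEquiv (f, (Torus.proj (2 * S + 1) 0, a, i)))
                      (quarkEquiv (f, (Torus.proj (2 * S + 1) (v), b, j)))‖) ^ s
                ∂(wilsonMeasure (fundamentalRep (Fin 3)) β)) /
              (∫ U : GaugeConfig 4 (2 * S + 1) (Matrix.specialUnitaryGroup (Fin 3) ℂ),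
                ‖(diracMatrix U mq).det‖ ∂(wilsonMeasure (fundamentalRep (Fin 3)) β)) ≤
            C * Real.exp (-(μ * s * ‖v‖)) := by
  intro Nf
  refine ⟨1440, Real.log (41 / 40), by norm_num, Real.log_pos (by norm_num), ?_⟩
  intro β mq f hf S s hs0 hs1 v hv
  -- the measure-theoretic template is the tree's `phaseQuenched_fractionalMoment_decay_of_heavy`
  set μ : ℝ := Real.log (41 / 40) with hμ
  have hμpos : 0 < μ := Real.log_pos (by norm_num)
  set θ : ℝ := 40 / 41 with hθ
  have hθpos : 0 < θ := by rw [hθ]; norm_num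
  have hlogθ : Real.log θ = -μ := by
    rw [hθ, hμ, ← Real.log_inv]
    congr 1
    norm_num
  -- the sup-distance `n = ‖v‖∞ = |v i₀|`, `i₀` a maximal coordinate
  obtain ⟨i₀, -, hmax⟩ :=
    Finset.exists_max_image Finset.univ (fun i : Fin 4 => ‖v i‖) Finset.univ_nonempty
  have hvi : |v i₀| ≤ (S : ℤ) := by
    have := Fintype.mem_piFinset.1 hv i₀
    rw [Finset.mem_Icc] at this
    exact abs_le.2 ⟨by linarith [this.1], this.2⟩
  set n : ℕ := (v i₀).natAbs with hn
  have hnorm : ‖v‖ ≤ (n : ℝ) := by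
    have h1 : ‖v‖ ≤ ‖v i₀‖ :=
      (pi_norm_le_iff_of_nonneg (norm_nonneg _)).2 fun i => hmax i (Finset.mem_univ i)
    rw [Int.norm_eq_abs] at h1
    rw [hn, Nat.cast_natAbs, Int.cast_abs]
    exact h1
  set K : ℝ := 10 * θ ^ n with hK
  have hcd : ((Torus.proj (2 * S + 1) (0 : Literature.Probability.LatticeModels.Site 4)) i₀ -
      (Torus.proj (2 * S + 1) v) i₀).valMinAbs.natAbs = n := by
    simp only [Torus.proj, Pi.zero_apply, Int.cast_zero, zero_sub]
    exact natAbs_valMinAbs_neg_intCast (v i₀) (by exact_mod_cast hvi)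
  -- entry bound at configurations where every flavour is invertible
  have hentry : ∀ U : GaugeConfig 4 (2 * S + 1) SU3,
      (∀ g, (wilsonDirac (fundamentalRep (Fin 3)) U (mq g) 1).det ≠ 0) →
      ∀ (a' : Fin 3) (i : Fin 4) (b : Fin 3) (j : Fin 4),
        ‖(diracMatrix U mq)⁻¹ (quarkEquiv (f, (Torus.proj (2 * S + 1) 0, a', i)))
          (quarkEquiv (f, (Torus.proj (2 * S + 1) v, b, j)))‖ ≤ K := by
    intro U hA a' i b j
    rw [inv_diracMatrix_apply_same_flavour U mq hA]
    have h := (norm_inv_wilsonDirac_apply_le_window (fundamentalRep (Fin 3))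
      fundamentalRep_mem_unitaryGroup U hf (Torus.proj (2 * S + 1) 0, a', i)
      (Torus.proj (2 * S + 1) v, b, j) i₀).2
    rwa [hcd] at h
  have hsum : ∀ U : GaugeConfig 4 (2 * S + 1) SU3,
      (∀ g, (wilsonDirac (fundamentalRep (Fin 3)) U (mq g) 1).det ≠ 0) →
      (∑ a' : Fin 3, ∑ i : Fin 4, ∑ b : Fin 3, ∑ j : Fin 4,
        ‖(diracMatrix U mq)⁻¹ (quarkEquiv (f, (Torus.proj (2 * S + 1) 0, a', i)))
          (quarkEquiv (f, (Torus.proj (2 * S + 1) v, b, j)))‖) ≤ 144 * K := by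
    intro U hA
    calc _ ≤ ∑ _a' : Fin 3, ∑ _i : Fin 4, ∑ _b : Fin 3, ∑ _j : Fin 4, K :=
          Finset.sum_le_sum fun a' _ => Finset.sum_le_sum fun i _ => Finset.sum_le_sum fun b _ =>
            Finset.sum_le_sum fun j _ => hentry U hA a' i b j
      _ = 144 * K := by simp; ring
  -- the uniform bound `B₀` on the fractional power of the sum
  set B₀ : ℝ := 1440 * Real.exp (-(μ * s * ‖v‖)) with hB₀
  have hB₀0 : 0 ≤ B₀ := by rw [hB₀]; positivity
  have hB : (144 * K) ^ s ≤ B₀ := by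
    have h1 : 144 * K = 1440 * θ ^ n := by rw [hK]; ring
    rw [h1, Real.mul_rpow (by norm_num) (by positivity), hB₀]
    refine mul_le_mul ?_ ?_ (by positivity) (by norm_num)
    · calc (1440 : ℝ) ^ s ≤ (1440 : ℝ) ^ (1 : ℝ) :=
            Real.rpow_le_rpow_of_exponent_le (by norm_num) hs1.le
        _ = 1440 := Real.rpow_one _
    · have h2 : θ ^ n = Real.exp ((n : ℝ) * Real.log θ) := by
        rw [Real.exp_nat_mul, Real.exp_log hθpos]
      rw [h2, ← Real.exp_mul, hlogθ]
      apply Real.exp_le_exp.2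
      have h3 : μ * s * ‖v‖ ≤ μ * s * n := mul_le_mul_of_nonneg_left hnorm (by positivity)
      linarith
  -- pointwise bound of the integrand (singular configurations carry zero weight)
  have hpt : ∀ U : GaugeConfig 4 (2 * S + 1) SU3,
      ‖(diracMatrix U mq).det‖ *
        (∑ a' : Fin 3, ∑ i : Fin 4, ∑ b : Fin 3, ∑ j : Fin 4,
          ‖(diracMatrix U mq)⁻¹ (quarkEquiv (f, (Torus.proj (2 * S + 1) 0, a', i)))
            (quarkEquiv (f, (Torus.proj (2 * S + 1) v, b, j)))‖) ^ s ≤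
        ‖(diracMatrix U mq).det‖ * B₀ := by
    intro U
    by_cases hA : ∀ g, (wilsonDirac (fundamentalRep (Fin 3)) U (mq g) 1).det ≠ 0
    · exact mul_le_mul_of_nonneg_left
        ((Real.rpow_le_rpow (by positivity) (hsum U hA) hs0.le).trans hB) (norm_nonneg _)
    · have h0 : ‖(diracMatrix U mq).det‖ = 0 := by
        push Not at hA
        obtain ⟨g, hg⟩ := hA
        rw [norm_det_diracMatrix]
        exact Finset.prod_eq_zero (Finset.mem_univ g) (by rw [norm_eq_zero]; exact hg)
      rw [h0, zero_mul, zero_mul]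
  have hnum : (∫ U : GaugeConfig 4 (2 * S + 1) SU3, ‖(diracMatrix U mq).det‖ *
      (∑ a' : Fin 3, ∑ i : Fin 4, ∑ b : Fin 3, ∑ j : Fin 4,
        ‖(diracMatrix U mq)⁻¹ (quarkEquiv (f, (Torus.proj (2 * S + 1) 0, a', i)))
          (quarkEquiv (f, (Torus.proj (2 * S + 1) v, b, j)))‖) ^ s
      ∂(wilsonMeasure (fundamentalRep (Fin 3)) β)) ≤
      (∫ U : GaugeConfig 4 (2 * S + 1) SU3, ‖(diracMatrix U mq).det‖
        ∂(wilsonMeasure (fundamentalRep (Fin 3)) β)) * B₀ := by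
    rw [← integral_mul_const]
    refine integral_mono_of_nonneg (Eventually.of_forall fun U => ?_)
      ((integrable_norm_det_diracMatrix mq _).mul_const B₀) (Eventually.of_forall fun U => hpt U)
    exact mul_nonneg (norm_nonneg _) (Real.rpow_nonneg (by positivity) _)
  have hZ0 : 0 ≤ ∫ U : GaugeConfig 4 (2 * S + 1) SU3, ‖(diracMatrix U mq).det‖
      ∂(wilsonMeasure (fundamentalRep (Fin 3)) β) := integral_nonneg fun U => norm_nonneg _
  rcases hZ0.eq_or_lt with hZ | hZ
  · rw [← hZ, div_zero]
    exact hB₀0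
  · rw [div_le_iff₀ hZ]
    exact hnum.trans_eq (mul_comm _ _)

end Summit.QuantumFields.QCD.Theorems.ThickCollarFarStability

end
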